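import Summits.KontsevichZagierPeriods.Zeta5Search.LaiSweepShard

/-!
# `κ₃` sweep certificate — shard file 089 of 127 (shards 623–629 of 889)

HONEST FRAMING. Systematic search; no irrationality claim unless certified. This file only checks,
by `decide +kernel`, shards 623–629 of the order-cell sweep of the `κ₃` point `(74, 2180, 444; δ74)`
(engine `LaiSweepEngine`, soundness `LaiSweepJump/Free/Eval/Shard/Kappa3`; a shard is `⟨regime, n,
p, q, p', q', Lo, Up⟩`: `n` cells from `p/q` to `p'/q'` with integer rate sums in `[Lo, Up]`, `K =
128`, `D = 2^40`). It draws NO conclusion: only the capstone `LaiKappa3SweepCert`, which needs all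
127 shard files, does. Kernel cost of this file ≈ 560 cells × 0.3 s.
-/

namespace Summit.KontsevichZagierPeriods.Zeta5Search.Sweep

set_option maxHeartbeats 100000000 in
/-- Shard 623: 80 cells of regime B from `187/281` to `261/391`.
[cite: Lai2024BallRivoal, §4 Lemma 4.3] -/
theorem shard623 :
    Shard.check 128 (2^40)
      ⟨true, 80, 187, 281, 261, 391, 20069545769142, 27909515307550⟩ = true := by
  decide +kernel

set_option maxHeartbeats 100000000 in
/-- Shard 624: 80 cells of regime B from `261/391` to `127/190`.
[cite: Lai2024BallRivoal, §4 Lemma 4.3] -/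
theorem shard624 :
    Shard.check 128 (2^40)
      ⟨true, 80, 261, 391, 127, 190, 8880611330162, 12363528912086⟩ = true := by
  decide +kernel

set_option maxHeartbeats 100000000 in
/-- Shard 625: 80 cells of regime B from `127/190` to `75/112`.
[cite: Lai2024BallRivoal, §4 Lemma 4.3] -/
theorem shard625 :
    Shard.check 128 (2^40)
      ⟨true, 80, 127, 190, 75, 112, 12036254073915, 16771579908464⟩ = true := by
  decide +kernel

set_option maxHeartbeats 100000000 in
/-- Shard 626: 80 cells of regime B from `75/112` to `161/240`.
[cite: Lai2024BallRivoal, §4 Lemma 4.3] -/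
theorem shard626 :
    Shard.check 128 (2^40)
      ⟨true, 80, 75, 112, 161, 240, 11710039759761, 16333368226068⟩ = true := by
  decide +kernel

set_option maxHeartbeats 100000000 in
/-- Shard 627: 80 cells of regime B from `161/240` to `289/430`.
[cite: Lai2024BallRivoal, §4 Lemma 4.3] -/
theorem shard627 :
    Shard.check 128 (2^40)
      ⟨true, 80, 161, 240, 289, 430, 12372807252666, 17275372607941⟩ = true := by
  decide +kernel

set_option maxHeartbeats 100000000 in
/-- Shard 628: 80 cells of regime B from `289/430` to `101/150`.
[cite: Lai2024BallRivoal, §4 Lemma 4.3] -/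
theorem shard628 :
    Shard.check 128 (2^40)
      ⟨true, 80, 289, 430, 101, 150, 12168777847083, 17008135232392⟩ = true := by
  decide +kernel

set_option maxHeartbeats 100000000 in
/-- Shard 629: 80 cells of regime B from `101/150` to `114/169`.
[cite: Lai2024BallRivoal, §4 Lemma 4.3] -/
theorem shard629 :
    Shard.check 128 (2^40)
      ⟨true, 80, 101, 150, 114, 169, 11983357854552, 16766106175769⟩ = true := by
  decide +kernel

/-- The checked shards of this file, in order. [folklore] -/
def shards089 : List (CheckedShard 128 (2^40)) :=
  [⟨_, shard623⟩, ⟨_, shard624⟩, ⟨_, shard625⟩, ⟨_, shard626⟩, ⟨_, shard627⟩,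
    ⟨_, shard628⟩, ⟨_, shard629⟩]

end Summit.KontsevichZagierPeriods.Zeta5Search.Sweep
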